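import Summits.RiemannHypothesis.RiemannHypothesis.Theorems.GroundBartaPolarPerronFrobeniusEvenSectorDeciding
import Summits.RiemannHypothesis.RiemannHypothesis.Theorems.GroundBartaPolarPerronFrobeniusEvenNormalForm
import Summits.RiemannHypothesis.RiemannHypothesis.Theorems.WeilGroundStateGroundStatesConvergeToXiEvenWitnessParity
import Literature.NumberTheory.LFunctions.WeilSemilocalCompactnessProofs
import HarnessLib

/-!
# Full ground states versus even-sector bottom states (route `RiemannHypothesis/GroundBarta`,
rung 3 `PolarPerronFrobenius`, stmt-RiemannHypothesis-18390)

Bridges between the FULL-form ground states of the crux (`IsWeilGroundState`) and the EVEN-SECTOR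
bottom states of the even-sector floor (`IsWeilEvenGroundState`,
Theorems/GroundBartaPolarPerronFrobeniusEvenFloor.lean), all RH-free:

* `isWeilEvenGroundState_evenPart` / `isWeilEvenGroundState_of_even_groundState`: the normalised
  even part of a full ground state (if not `0` in `L²`) — in particular an EVEN full ground state —
  is an even-sector bottom state (symmetrise the minimising sequence; its energies tend to
  `ε(a) ≤ ε_ev(a)` while even normalised tests have energy `≥ ε_ev(a)`, so `ε_ev(a) = ε(a)`);
* `exists_evenSectorOneSigned_of_oneSigned`: a window carrying a one-signed FULL ground state
  carries a one-signed EVEN-SECTOR bottom state (`exists_even_real_nonneg_of_oneSigned`);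
  hence `riemannHypothesis_of_cofinal_oneSigned` (cofinal full GSP ⇒ RH, landed in ParitySign)
  is RE-DERIVED from the strictly more general even-sector deciding theorem
  `riemannHypothesis_of_cofinal_evenSectorOneSigned` (`riemannHypothesis_of_cofinal_oneSigned'`);
* `isWeilGroundState_of_isWeilEvenGroundState`: at an even-winning window (`ε_ev(a) ≤ ε_od(a)`)
  an even-sector bottom state is a full ground state;
* `exists_isWeilEvenGroundState`: even-sector bottom states EXIST at every window `a > 0`
  (compactness of the form embedding, Connes–Consani–Moscovici 2025 Thm 3.6, PROVED in tree) —
  the objects of the even-sector floor and of the draft route `EvenSectorBarta` are never vacuous;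
* `polarPerronFrobenius_iff_evenSector`: the crux in even-sector language — beyond every height a
  window at which even-winning implies a one-signed EVEN-SECTOR bottom state.
References: Bombieri 2000 §4 (Problem 2, Thm 3, Thm 5); Connes–Consani–Moscovici 2025 Thm 3.6.
-/

set_option linter.dupNamespace false

noncomputable section

open Set MeasureTheory Filter Complex
open scoped Real Topology ComplexConjugate

namespace Summit.RiemannHypothesis.RiemannHypothesis.Theorems.PolarPerronFrobenius

open Literature.NumberTheory.LFunctions
open Summit.RiemannHypothesis.RiemannHypothesis.Theses.GroundBarta
open Summit.RiemannHypothesis.RiemannHypothesis.Theorems.GroundStatesConvergeToXi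

/-! ## The normalised even part of a full ground state is an even-sector bottom state -/

/-- **The normalised even part of a ground state is an EVEN-SECTOR bottom state.**  If `u` is a
ground state of the full windowed form at `a` whose even part `uᵉ = ½(u + u(-·))` is not `0` in
`L²`, then `uᵉ/‖uᵉ‖₂` is an even-sector bottom state (`IsWeilEvenGroundState`): the normalised
even parts `eₙ/‖eₙ‖₂` of the minimising sequence are even normalised window tests converging to
`uᵉ/‖uᵉ‖₂` in `L²` with energies `→ ε(a)`; as even normalised tests they have energy `≥ ε_ev(a)`,
so the limit `ε(a)` equals `ε_ev(a)` (`ε ≤ ε_ev` always).  The `L²` bookkeeping is that of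
`GroundStatesConvergeToXi.isWeilGroundState_evenPart`, verbatim. [cite: Bombieri2000Weil, §4 Thm 3 (proof) and Thm 5] -/
theorem isWeilEvenGroundState_evenPart {a : ℝ} {u : ℝ → ℂ} (hu : IsWeilGroundState a u)
    (hN : 0 < ∫ t, ‖(u t + u (-t)) / 2‖ ^ 2) :
    IsWeilEvenGroundState a (fun t =>
      (((Real.sqrt (∫ s, ‖(u s + u (-s)) / 2‖ ^ 2))⁻¹ : ℝ) : ℂ) * ((u t + u (-t)) / 2)) := by
  -- adapted from `GroundStatesConvergeToXi.isWeilGroundState_evenPart`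
  obtain ⟨hmem, g, hg, hQ, hL⟩ := hu
  set N : ℝ := ∫ s, ‖(u s + u (-s)) / 2‖ ^ 2 with hNdef
  set ε : ℝ := weilGroundEnergy a with hεdef
  set e : ℕ → ℝ → ℂ := fun n t => (g n t + g n (-t)) / 2 with hedef
  set o : ℕ → ℝ → ℂ := fun n t => (g n t - g n (-t)) / 2 with hodef
  set ue : ℝ → ℂ := fun t => (u t + u (-t)) / 2 with huedef
  have hgm : ∀ n, MemLp (g n) 2 := fun n =>
    (hg n).1.1.continuous.memLp_of_hasCompactSupport (hg n).1.2
  have het : ∀ n, IsWeilTest (e n) := fun n => (hg n).1.evenPart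
  have hot : ∀ n, IsWeilTest (o n) := fun n => (hg n).1.oddPart
  have hes : ∀ n, tsupport (e n) ⊆ Icc (-a) a := fun n => tsupport_evenPart_subset_Icc (hg n).2.1
  have hos : ∀ n, tsupport (o n) ⊆ Icc (-a) a := fun n => tsupport_oddPart_subset_Icc (hg n).2.1
  have hem : ∀ n, MemLp (e n) 2 := fun n => memLp_evenPart (hgm n)
  have huem : MemLp ue 2 := memLp_evenPart hmem
  have heev : ∀ n t, e n (-t) = e n t := fun n t => by
    simp only [hedef, neg_neg, add_comm (g n (-t)) (g n t)]
  set Ne : ℕ → ℝ := fun n => ∫ t, ‖e n t‖ ^ 2 with hNedef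
  have hsplit : ∀ n, Ne n + ∫ t, ‖o n t‖ ^ 2 = 1 := fun n => by
    have := integral_norm_sq_evenPart_add_oddPart_of_memLp (hgm n)
    rw [(hg n).2.2] at this
    exact this
  have hQsplit : ∀ n, (weilQuadratic (g n)).re =
      (weilQuadratic (e n)).re + (weilQuadratic (o n)).re := fun n => by
    rw [weilQuadratic_eq_evenPart_add_oddPart (hg n).1, Complex.add_re]
  have hlow : ∀ n, ε * Ne n ≤ (weilQuadratic (e n)).re := fun n =>
    weilGroundEnergy_mul_integral_norm_sq_le (het n) (hes n)
  have hupp : ∀ n, (weilQuadratic (e n)).re ≤ (weilQuadratic (g n)).re - ε * (1 - Ne n) := by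
    intro n
    have h1 := weilGroundEnergy_mul_integral_norm_sq_le (hot n) (hos n)
    have h2 := hsplit n
    have h3 := hQsplit n
    have h4 : ∫ t, ‖o n t‖ ^ 2 = 1 - Ne n := by linarith
    rw [h4] at h1
    linarith
  have hD : Tendsto (fun n => ∫ t, ‖e n t - ue t‖ ^ 2) atTop (𝓝 0) := by
    refine squeeze_zero (fun n => integral_nonneg fun _ => by positivity) (fun n => ?_) hL
    have h1 := integral_norm_sq_evenPart_le_of_memLp ((hgm n).sub hmem)
    have e1 : (fun t => ‖e n t - ue t‖ ^ 2) =
        fun t => ‖((g n - u) t + (g n - u) (-t)) / 2‖ ^ 2 := by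
      funext t
      simp only [hedef, huedef, Pi.sub_apply]
      congr 2
      ring
    rw [e1]
    simpa only [Pi.sub_apply] using h1
  have hNe : Tendsto Ne atTop (𝓝 N) := by
    have hsqrt : Tendsto (fun n => Real.sqrt (∫ t, ‖e n t - ue t‖ ^ 2)) atTop (𝓝 0) := by
      simpa using hD.sqrt
    set S : ℝ := Real.sqrt N with hS
    have h1 : ∀ n, Real.sqrt (Ne n) ≤ S + Real.sqrt (∫ t, ‖e n t - ue t‖ ^ 2) := fun n => by
      have := sqrt_integral_norm_sq_sub_le huem (huem.sub (hem n))
      simpa only [Pi.sub_apply, sub_sub_cancel, norm_sub_rev (ue _)] using this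
    have h2 : ∀ n, S ≤ Real.sqrt (Ne n) + Real.sqrt (∫ t, ‖e n t - ue t‖ ^ 2) := fun n => by
      have := sqrt_integral_norm_sq_sub_le (hem n) ((hem n).sub huem)
      simpa only [Pi.sub_apply, sub_sub_cancel] using this
    have h3 : Tendsto (fun n => Real.sqrt (Ne n)) atTop (𝓝 S) := by
      have hup : Tendsto (fun n => S + Real.sqrt (∫ t, ‖e n t - ue t‖ ^ 2)) atTop (𝓝 S) := by
        simpa using tendsto_const_nhds.add hsqrt
      have hlo : Tendsto (fun n => S - Real.sqrt (∫ t, ‖e n t - ue t‖ ^ 2)) atTop (𝓝 S) := by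
        simpa using tendsto_const_nhds.sub hsqrt
      exact tendsto_of_tendsto_of_tendsto_of_le_of_le hlo hup (fun n => by linarith [h2 n])
        (fun n => h1 n)
    have h4 : Tendsto (fun n => Real.sqrt (Ne n) ^ 2) atTop (𝓝 (S ^ 2)) := h3.pow 2
    have h5 : ∀ n, Real.sqrt (Ne n) ^ 2 = Ne n := fun n =>
      Real.sq_sqrt (integral_nonneg fun _ => by positivity)
    simp only [h5] at h4
    rwa [hS, Real.sq_sqrt hN.le] at h4
  have hQe : Tendsto (fun n => (weilQuadratic (e n)).re) atTop (𝓝 (ε * N)) := by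
    have hlo : Tendsto (fun n => ε * Ne n) atTop (𝓝 (ε * N)) := tendsto_const_nhds.mul hNe
    have hup : Tendsto (fun n => (weilQuadratic (g n)).re - ε * (1 - Ne n)) atTop
        (𝓝 (ε * N)) := by
      have h1 : Tendsto (fun n => ε * (1 - Ne n)) atTop (𝓝 (ε * (1 - N))) :=
        tendsto_const_nhds.mul (tendsto_const_nhds.sub hNe)
      have h2 := hQ.sub h1
      convert h2 using 2
      ring
    exact tendsto_of_tendsto_of_tendsto_of_le_of_le hlo hup hlow hupp
  obtain ⟨n₀, hn₀⟩ := eventually_atTop.1 (hNe.eventually (lt_mem_nhds (by linarith : N / 2 < N)))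
  have hNepos : ∀ n, 0 < Ne (n + n₀) := fun n => by
    have := hn₀ (n + n₀) (Nat.le_add_left _ _)
    linarith
  set r : ℕ → ℝ := fun n => (Real.sqrt (Ne (n + n₀)))⁻¹ with hrdef
  set R : ℝ := (Real.sqrt N)⁻¹ with hRdef
  have hrpos : ∀ n, 0 < r n := fun n => inv_pos.2 (Real.sqrt_pos.2 (hNepos n))
  have hr2 : ∀ n, r n ^ 2 = (Ne (n + n₀))⁻¹ := fun n => by
    rw [hrdef]
    dsimp only
    rw [inv_pow, Real.sq_sqrt (hNepos n).le]
  have hrR : Tendsto r atTop (𝓝 R) :=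
    ((hNe.comp (tendsto_add_atTop_nat n₀)).sqrt.inv₀ (Real.sqrt_ne_zero'.2 hN))
  -- the even normalised sequence
  have hseq : ∀ n, IsWeilTest (fun t => ((r n : ℝ) : ℂ) * e (n + n₀) t) ∧
      tsupport (fun t => ((r n : ℝ) : ℂ) * e (n + n₀) t) ⊆ Icc (-a) a ∧
      (∀ t, ((r n : ℝ) : ℂ) * e (n + n₀) (-t) = ((r n : ℝ) : ℂ) * e (n + n₀) t) ∧
      ∫ t, ‖((r n : ℝ) : ℂ) * e (n + n₀) t‖ ^ 2 = (1 : ℝ) := by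
    intro n
    refine ⟨(het _).const_mul _, tsupport_mul_subset_right.trans (hes _), fun t => by
      rw [heev], ?_⟩
    simp only [norm_mul, mul_pow, Complex.norm_real, Real.norm_of_nonneg (hrpos n).le]
    rw [integral_const_mul, hr2 n]
    exact inv_mul_cancel₀ (hNepos n).ne'
  -- energies `→ ε`
  have hQn : Tendsto (fun n => (weilQuadratic (fun t => ((r n : ℝ) : ℂ) * e (n + n₀) t)).re)
      atTop (𝓝 ε) := by
    have key : ∀ n, (weilQuadratic (fun t => ((r n : ℝ) : ℂ) * e (n + n₀) t)).re =
        (Ne (n + n₀))⁻¹ * (weilQuadratic (e (n + n₀))).re := fun n => by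
      rw [weilQuadratic_const_mul, Complex.normSq_ofReal, Complex.re_ofReal_mul, ← sq, hr2 n]
    have h1 : Tendsto (fun n => (Ne (n + n₀))⁻¹ * (weilQuadratic (e (n + n₀))).re) atTop
        (𝓝 (N⁻¹ * (ε * N))) :=
      ((hNe.comp (tendsto_add_atTop_nat n₀)).inv₀ hN.ne').mul
        (hQe.comp (tendsto_add_atTop_nat n₀))
    have h2 : N⁻¹ * (ε * N) = ε := by field_simp
    rw [h2] at h1
    exact h1.congr fun n => (key n).symm
  -- hence `ε_ev(a) = ε(a)`, and the energies tend to `ε_ev(a)`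
  have hεev : weilEvenGroundEnergy a = ε := by
    refine le_antisymm ?_ (weilGroundEnergy_le_weilEvenGroundEnergy a)
    exact ge_of_tendsto' hQn fun n =>
      weilEvenGroundEnergy_le (hseq n).1 (hseq n).2.1 (hseq n).2.2.1 (hseq n).2.2.2
  have hQn' : Tendsto (fun n => (weilQuadratic (fun t => ((r n : ℝ) : ℂ) * e (n + n₀) t)).re)
      atTop (𝓝 (weilEvenGroundEnergy a)) := by
    rw [hεev]; exact hQn
  -- `L²` convergence to `R uᵉ`
  have hconv : Tendsto (fun n => ∫ t, ‖((r n : ℝ) : ℂ) * e (n + n₀) t - (R : ℂ) * ue t‖ ^ 2)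
      atTop (𝓝 0) := by
    have hD' : Tendsto (fun n => ∫ t, ‖e (n + n₀) t - ue t‖ ^ 2) atTop (𝓝 0) :=
      hD.comp (tendsto_add_atTop_nat n₀)
    have hNe' : Tendsto (fun n => Ne (n + n₀)) atTop (𝓝 N) := hNe.comp (tendsto_add_atTop_nat n₀)
    have hpt : ∀ n t, ‖((r n : ℝ) : ℂ) * e (n + n₀) t - (R : ℂ) * ue t‖ ^ 2 ≤
        2 * (r n - R) ^ 2 * ‖e (n + n₀) t‖ ^ 2 + 2 * R ^ 2 * ‖e (n + n₀) t - ue t‖ ^ 2 := by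
      intro n t
      have e1 : ((r n : ℝ) : ℂ) * e (n + n₀) t - (R : ℂ) * ue t =
          ((r n - R : ℝ) : ℂ) * e (n + n₀) t + (R : ℂ) * (e (n + n₀) t - ue t) := by
        push_cast
        ring
      rw [e1]
      have h1 := norm_add_le (((r n - R : ℝ) : ℂ) * e (n + n₀) t) ((R : ℂ) * (e (n + n₀) t - ue t))
      rw [norm_mul, norm_mul, Complex.norm_real, Complex.norm_real, Real.norm_eq_abs,
        Real.norm_eq_abs] at h1
      have h2 : 0 ≤ |r n - R| * ‖e (n + n₀) t‖ := by positivity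
      have h3 : 0 ≤ |R| * ‖e (n + n₀) t - ue t‖ := by positivity
      calc ‖((r n - R : ℝ) : ℂ) * e (n + n₀) t + (R : ℂ) * (e (n + n₀) t - ue t)‖ ^ 2
          ≤ (|r n - R| * ‖e (n + n₀) t‖ + |R| * ‖e (n + n₀) t - ue t‖) ^ 2 :=
            pow_le_pow_left₀ (norm_nonneg _) h1 2
        _ ≤ 2 * (|r n - R| * ‖e (n + n₀) t‖) ^ 2 + 2 * (|R| * ‖e (n + n₀) t - ue t‖) ^ 2 := by
            nlinarith [sq_nonneg (|r n - R| * ‖e (n + n₀) t‖ - |R| * ‖e (n + n₀) t - ue t‖)]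
        _ = 2 * (r n - R) ^ 2 * ‖e (n + n₀) t‖ ^ 2 + 2 * R ^ 2 * ‖e (n + n₀) t - ue t‖ ^ 2 := by
            rw [mul_pow, mul_pow, sq_abs, sq_abs]; ring
    have hbound : ∀ n, ∫ t, ‖((r n : ℝ) : ℂ) * e (n + n₀) t - (R : ℂ) * ue t‖ ^ 2 ≤
        2 * (r n - R) ^ 2 * Ne (n + n₀) + 2 * R ^ 2 * ∫ t, ‖e (n + n₀) t - ue t‖ ^ 2 := by
      intro n
      have hi1 : Integrable fun t => ‖e (n + n₀) t‖ ^ 2 := integrable_norm_sq_of_memLp (hem _)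
      have hi2 : Integrable fun t => ‖e (n + n₀) t - ue t‖ ^ 2 :=
        integrable_norm_sq_of_memLp ((hem _).sub huem)
      have hi3 : Integrable fun t =>
          2 * (r n - R) ^ 2 * ‖e (n + n₀) t‖ ^ 2 + 2 * R ^ 2 * ‖e (n + n₀) t - ue t‖ ^ 2 :=
        (hi1.const_mul (2 * (r n - R) ^ 2)).add (hi2.const_mul (2 * R ^ 2))
      have := integral_mono_of_nonneg (Eventually.of_forall fun t => by positivity) hi3
        (Eventually.of_forall (hpt n))
      rw [integral_add (hi1.const_mul _) (hi2.const_mul _), integral_const_mul,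
        integral_const_mul] at this
      exact this
    have hlim0 : Tendsto (fun n => 2 * (r n - R) ^ 2 * Ne (n + n₀) +
        2 * R ^ 2 * ∫ t, ‖e (n + n₀) t - ue t‖ ^ 2) atTop (𝓝 0) := by
      have h1 : Tendsto (fun n => r n - R) atTop (𝓝 0) := by
        simpa using hrR.sub_const R
      have h2 : Tendsto (fun n => 2 * (r n - R) ^ 2 * Ne (n + n₀)) atTop (𝓝 (2 * 0 ^ 2 * N)) :=
        (tendsto_const_nhds.mul (h1.pow 2)).mul hNe'
      have h3 : Tendsto (fun n => 2 * R ^ 2 * ∫ t, ‖e (n + n₀) t - ue t‖ ^ 2) atTop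
          (𝓝 (2 * R ^ 2 * 0)) :=
        tendsto_const_nhds.mul hD'
      simpa using h2.add h3
    exact squeeze_zero (fun n => integral_nonneg fun _ => by positivity) hbound hlim0
  exact IsWeilEvenGroundState.of_tendsto (huem.const_mul _) hseq hQn' hconv

/-- **An EVEN full ground state is an even-sector bottom state.** [folklore] -/
theorem isWeilEvenGroundState_of_even_groundState {a : ℝ} {u : ℝ → ℂ} (hu : IsWeilGroundState a u)
    (heven : ∀ t, u (-t) = u t) : IsWeilEvenGroundState a u := by
  have hue : ∀ t, (u t + u (-t)) / 2 = u t := fun t => by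
    rw [heven]; ring
  have hint : ∫ t, ‖(u t + u (-t)) / 2‖ ^ 2 = 1 := by
    simp_rw [hue]; exact hu.integral_norm_sq
  have hN : 0 < ∫ t, ‖(u t + u (-t)) / 2‖ ^ 2 := by
    rw [hint]; exact one_pos
  have h := isWeilEvenGroundState_evenPart hu hN
  have hfun : (fun t => (((Real.sqrt (∫ s, ‖(u s + u (-s)) / 2‖ ^ 2))⁻¹ : ℝ) : ℂ) *
      ((u t + u (-t)) / 2)) = u := by
    funext t
    rw [hint, hue, Real.sqrt_one, inv_one]
    push_cast
    ring
  rwa [hfun] at h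

/-- **A one-signed full ground state yields a one-signed even-sector bottom state** (take the
even, real, everywhere `≥ 0` ground state of `exists_even_real_nonneg_of_oneSigned`). [folklore] -/
theorem exists_evenSectorOneSigned_of_oneSigned {a : ℝ} {u : ℝ → ℂ} (hu : IsWeilGroundState a u)
    (hsign : ∀ᵐ t : ℝ, t ∈ Ioo (-a) a → (u t).im = 0 ∧ 0 ≤ (u t).re) :
    ∃ v : ℝ → ℂ, IsWeilEvenGroundState a v ∧
      (∀ᵐ t : ℝ, t ∈ Ioo (-a) a → (v t).im = 0 ∧ 0 ≤ (v t).re) := by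
  obtain ⟨v, hv, hev, hre, hnn⟩ := exists_even_real_nonneg_of_oneSigned hu hsign
  exact ⟨v, isWeilEvenGroundState_of_even_groundState hv hev,
    Eventually.of_forall fun t _ => ⟨hre t, hnn t⟩⟩

/-- **Cofinal one-signed FULL ground states decide RH** — `riemannHypothesis_of_cofinal_oneSigned`
(Theorems/GroundBartaPolarPerronFrobeniusParitySign.lean) RE-DERIVED from the even-sector
deciding theorem, which it therefore does not exceed in strength. [folklore] -/
theorem riemannHypothesis_of_cofinal_oneSigned'
    (hcof : ∀ A : ℝ, ∃ a : ℝ, A ≤ a ∧ ∃ u : ℝ → ℂ, IsWeilGroundState a u ∧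
      (∀ᵐ t : ℝ, t ∈ Ioo (-a) a → (u t).im = 0 ∧ 0 ≤ (u t).re)) :
    RiemannHypothesis := by
  refine riemannHypothesis_of_cofinal_evenSectorOneSigned fun A => ?_
  obtain ⟨a, ha, u, hu, hsign⟩ := hcof A
  obtain ⟨v, hv, hvsign⟩ := exists_evenSectorOneSigned_of_oneSigned hu hsign
  exact ⟨a, ha, v, hv, hvsign⟩

/-! ## Even-sector bottom states at even-winning windows are full ground states -/

/-- **At an even-winning window an even-sector bottom state is a ground state of the full form**
(`ε(a) = min(ε_ev(a), ε_od(a)) = ε_ev(a)`). [folklore] -/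
theorem isWeilGroundState_of_isWeilEvenGroundState {a : ℝ} {u : ℝ → ℂ}
    (hu : IsWeilEvenGroundState a u) (hle : weilEvenGroundEnergy a ≤ weilOddGroundEnergy a) :
    IsWeilGroundState a u := by
  obtain ⟨g, hg, hQ, hL⟩ := hu.exists_tendsto
  have hε : weilGroundEnergy a = weilEvenGroundEnergy a := by
    rw [weilGroundEnergy_eq_min_even_odd, min_eq_left hle]
  refine ⟨hu.memLp, g, fun n => ⟨(hg n).1, (hg n).2.1, (hg n).2.2.2⟩, ?_, hL⟩
  rw [hε]; exact hQ

/-- **Existence of even-sector bottom states at every window `a > 0`** (RH-free): an even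
minimising sequence of the even sphere (`exists_weilEvenMinimizingSeq`) has bounded energies, so by
the compactness of the form embedding (Connes–Consani–Moscovici 2025 Thm 3.6, PROVED in the tree as
`ConnesConsaniMoscovici2025_thm_3_6_holds`) a subsequence converges in `L²`; its limit is an
even-sector bottom state. [cite: ConnesConsaniMoscovici2025, Thm. 3.6] -/
theorem exists_isWeilEvenGroundState {a : ℝ} (ha : 0 < a) : ∃ u : ℝ → ℂ, IsWeilEvenGroundState a u := by
  obtain ⟨e, he, hQ⟩ := exists_weilEvenMinimizingSeq ha
  obtain ⟨u, hu, φ, hφ, hconv⟩ := ConnesConsaniMoscovici2025_thm_3_6_holds a ha e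
    (fun n => ⟨(he n).1, (he n).2.1, (he n).2.2.2⟩) hQ.bddAbove_range
  exact ⟨u, IsWeilEvenGroundState.of_tendsto hu (fun n => he (φ n)) (hQ.comp hφ.tendsto_atTop) hconv⟩

/-! ## The crux in even-sector language -/

/-- **`PolarPerronFrobenius` in even-sector language**: the crux holds iff beyond every height there
is a window `a` at which even-winning (`ε_ev(a) ≤ ε_od(a)`) implies the existence of an EVEN-SECTOR
bottom state that is real and `≥ 0` a.e. on `(-a, a)` (`polarPerronFrobenius_iff_groundEnergy` +
the two bridges).  Dropping the even-winning premise gives the strictly simpler sufficient condition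
of `riemannHypothesis_of_cofinal_evenSectorOneSigned`, which needs no rung-4 input. [folklore] -/
theorem polarPerronFrobenius_iff_evenSector :
    PolarPerronFrobenius ↔
      ∀ A : ℝ, ∃ a : ℝ, A ≤ a ∧ (weilEvenGroundEnergy a ≤ weilOddGroundEnergy a →
        ∃ u : ℝ → ℂ, IsWeilEvenGroundState a u ∧
          ∀ᵐ t : ℝ, t ∈ Ioo (-a) a → (u t).im = 0 ∧ 0 ≤ (u t).re) := by
  rw [polarPerronFrobenius_iff_groundEnergy]
  refine forall_congr' fun A => exists_congr fun a => and_congr_right fun _ =>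
    ⟨fun h hle => ?_, fun h hle => ?_⟩
  · obtain ⟨u, hu, hsign⟩ := h hle
    exact exists_evenSectorOneSigned_of_oneSigned hu hsign
  · obtain ⟨u, hu, hsign⟩ := h hle
    exact ⟨u, isWeilGroundState_of_isWeilEvenGroundState hu hle, hsign⟩

/-- **The crux from cofinal one-signed even-sector bottom states** (the `EW`-free sufficient
condition, which by `riemannHypothesis_of_cofinal_evenSectorOneSigned` already gives RH on its
own). [folklore] -/
theorem polarPerronFrobenius_of_cofinal_evenSectorOneSigned
    (hcof : ∀ A : ℝ, ∃ a : ℝ, A ≤ a ∧ ∃ u : ℝ → ℂ, IsWeilEvenGroundState a u ∧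
      (∀ᵐ t : ℝ, t ∈ Ioo (-a) a → (u t).im = 0 ∧ 0 ≤ (u t).re)) :
    PolarPerronFrobenius :=
  polarPerronFrobenius_iff_evenSector.2 fun A => (hcof A).imp fun _ ha => ⟨ha.1, fun _ => ha.2⟩

end Summit.RiemannHypothesis.RiemannHypothesis.Theorems.PolarPerronFrobenius

end
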